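import Mathlib.Data.Nat.Dist
import Summits.AtomisticToContinuum.FouriersLaw.Theorems.HeatModeWeylLawSpecificHeatLimitCovarianceBounds
import HarnessLib

/-!
# Transfer-operator covariances, III: the packaged decay / bulk-limit / summability statement

Helper file for item `stmt-AtomisticToContinuum-12398` (`SpecificHeatLimit`, route `HeatModeWeylLaw`
of `AtomisticToContinuum/FouriersLaw`); continuation of `…CovarianceBounds.lean`. Given a symmetric
bounded operator `A` with top eigenvector `φ` (`Aφ = λφ`) and geometric convergence of its powers to
the top eigenprojection (`Literature.Analysis.OperatorTheory.IsPositivityImproving.exists_norm_pow_sub_le`),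
a symmetric insertion `H₁`, an insertion `H₂` and a boundary vector `b`, `exists_covariance_bounds`
translates the finite-volume one- and two-point functions `e1 n l`, `e2 n l m` (matrix elements of
`Aˡ H₁ A^{…} H₁ A^{…}` between `b`'s, divided by the partition function `⟪b, Aⁿ b⟫`) into the
normalised form of part II and delivers the three hypotheses of the Cesàro lemma
(`HeatModeWeylLawSpecificHeatLimitCesaro.lean`): uniform decay `C₁ r^{|l-m|}`, bulk convergence
`C₂ (r^{min l m} + r^{n-1-max l m})`, summability `|C(d)| ≤ C₃ rᵈ`. [folklore]; no definitions.
-/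

noncomputable section

open Filter Topology
open scoped RealInnerProductSpace

namespace Summit.AtomisticToContinuum.FouriersLaw.Theorems.SpecificHeatLimit

open Literature.Analysis.OperatorTheory

/-! ### Packaging: the covariance array of a transfer operator with a gap -/

section Packaging

variable {E : Type*} [NormedAddCommGroup E] [InnerProductSpace ℝ E]
  {A H₁ H₂ : E →L[ℝ] E} {φ b : E} {lam θ zs : ℝ}

/-- **Uniform decay, bulk convergence and summability of the transfer-operator covariances.**
Let `A` be a bounded symmetric operator on a real inner product space with a unit vector `φ`,
`Aφ = λφ` (`λ > 0`), whose powers converge to the top eigenprojection at a geometric rate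
`‖Aⁿ g - λⁿ⟪φ, g⟫ φ‖ ≤ θⁿ ‖g‖` (`0 ≤ θ < λ`; e.g. a compact self-adjoint positivity improving
transfer operator, `IsPositivityImproving.exists_norm_pow_sub_le`), let `H₁` (symmetric) and `H₂` be
bounded insertion operators and `b` a boundary vector whose partition functions obey
`⟪b, Aⁿ b⟫ ≥ z_* λⁿ`, `z_* ≤ ⟪φ, b⟫²`, `z_* > 0`. For `n` bonds, the one-point functions
`e1 n l = ⟪Aˡ b, H₁ A^{n-1-l} b⟫ / ⟪b, Aⁿ b⟫`, the two-point functions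
`e2 n l m = ⟪Aˡ b, H₁ A^{m-l-1} H₁ A^{n-1-m} b⟫ / ⟪b, Aⁿ b⟫` (`l < m`, symmetric in `l, m`, and with
`H₂` on the diagonal) and the covariances `c n l m = e2 n l m - e1 n l · e1 n m` satisfy, for some
constants `C₁, C₂, C₃` and `r < 1`: (decay) `|c n l m| ≤ C₁ r^{|l-m|}`; (bulk limit)
`|c n l m - C(|l-m|)| ≤ C₂ (r^{min l m} + r^{n-1-max l m})` with
`C(0) = ⟪φ, H₂φ⟫/λ - (⟪φ, H₁φ⟫/λ)²`, `C(d) = ⟪H₁φ, A^{d-1} H₁φ⟫/λ^{d+1} - (⟪φ, H₁φ⟫/λ)²` (`d ≥ 1`);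
(summability) `|C(d)| ≤ C₃ rᵈ`. [folklore] -/
theorem exists_covariance_bounds
    (hA : ∀ x y, ⟪A x, y⟫ = ⟪x, A y⟫) (hH₁ : ∀ x y, ⟪H₁ x, y⟫ = ⟪x, H₁ y⟫)
    (hφ : ‖φ‖ = 1) (hAφ : A φ = lam • φ) (hlam : 0 < lam) (hθ0 : 0 ≤ θ) (hθ : θ < lam)
    (hpow : ∀ (n : ℕ) (g : E), ‖(A ^ n) g - (lam ^ n * ⟪φ, g⟫) • φ‖ ≤ θ ^ n * ‖g‖)
    (hzs : 0 < zs) (hz : ∀ n, zs * lam ^ n ≤ ⟪b, (A ^ n) b⟫) (hzc : zs ≤ ⟪φ, b⟫ ^ 2)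
    (e1 : ℕ → ℕ → ℝ)
    (he1 : ∀ n l, l < n → e1 n l = ⟪(A ^ l) b, H₁ ((A ^ (n - 1 - l)) b)⟫ / ⟪b, (A ^ n) b⟫)
    (e2 : ℕ → ℕ → ℕ → ℝ)
    (he2 : ∀ n l m, l < m → m < n →
      e2 n l m = ⟪(A ^ l) b, H₁ ((A ^ (m - l - 1)) (H₁ ((A ^ (n - 1 - m)) b)))⟫ / ⟪b, (A ^ n) b⟫)
    (he2s : ∀ n l m, e2 n l m = e2 n m l)
    (he2d : ∀ n l, l < n → e2 n l l = ⟪(A ^ l) b, H₂ ((A ^ (n - 1 - l)) b)⟫ / ⟪b, (A ^ n) b⟫)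
    (Cf : ℕ → ℝ) (hCf0 : Cf 0 = ⟪φ, H₂ φ⟫ / lam - (⟪φ, H₁ φ⟫ / lam) ^ 2)
    (hCf : ∀ d, 0 < d →
      Cf d = ⟪H₁ φ, (A ^ (d - 1)) (H₁ φ)⟫ / lam ^ (d + 1) - (⟪φ, H₁ φ⟫ / lam) ^ 2) :
    ∃ C₁ C₂ C₃ r : ℝ, 0 ≤ r ∧ r < 1 ∧
      (∀ n l m, l < n → m < n → |e2 n l m - e1 n l * e1 n m| ≤ C₁ * r ^ Nat.dist l m) ∧
      (∀ n l m, l < n → m < n → |(e2 n l m - e1 n l * e1 n m) - Cf (Nat.dist l m)| ≤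
        C₂ * (r ^ min l m + r ^ (n - 1 - max l m))) ∧
      (∀ d, |Cf d| ≤ C₃ * r ^ d) := by
  -- ### normalisation `At = λ⁻¹ A`, `r = max (θ/λ) (1/2)`
  set At : E →L[ℝ] E := lam⁻¹ • A with hAt
  set r : ℝ := max (θ / lam) (1 / 2) with hr
  have hr0 : 0 ≤ r := le_max_of_le_right (by norm_num)
  have hr1 : r < 1 := max_lt ((div_lt_one hlam).2 hθ) (by norm_num)
  have hr1' : r ≤ 1 := hr1.le
  have hrhalf : (1 : ℝ) / 2 ≤ r := le_max_right _ _
  have hlam0 : lam ≠ 0 := hlam.ne'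
  have hAtφ : At φ = φ := by
    rw [hAt, FunLike.coe_smul, Pi.smul_apply, hAφ, smul_smul, inv_mul_cancel₀ hlam0, one_smul]
  have hsym : ∀ x y, ⟪At x, y⟫ = ⟪x, At y⟫ := fun x y => by
    simp only [hAt, FunLike.coe_smul, Pi.smul_apply, real_inner_smul_left, real_inner_smul_right, hA]
  have hApow : ∀ (j : ℕ) (v : E), (A ^ j) v = lam ^ j • (At ^ j) v := by
    intro j v
    have hAeq : A = lam • At := by rw [hAt, smul_smul, mul_inv_cancel₀ hlam0, one_smul]
    conv_lhs => rw [hAeq, smul_pow]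
    rfl
  have hpow' : ∀ (j : ℕ) (g : E), ‖(At ^ j) g - ⟪φ, g⟫ • φ‖ ≤ r ^ j * ‖g‖ := by
    intro j g
    have hlj : 0 < lam ^ j := pow_pos hlam j
    have h1 : (At ^ j) g - ⟪φ, g⟫ • φ = (lam ^ j)⁻¹ • ((A ^ j) g - (lam ^ j * ⟪φ, g⟫) • φ) := by
      rw [hApow, smul_sub, smul_smul, smul_smul, inv_mul_cancel₀ hlj.ne', one_smul, ← mul_assoc,
        inv_mul_cancel₀ hlj.ne', one_mul]
    rw [h1, norm_smul, norm_inv, norm_pow, Real.norm_of_nonneg hlam.le]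
    calc (lam ^ j)⁻¹ * ‖(A ^ j) g - (lam ^ j * ⟪φ, g⟫) • φ‖ ≤ (lam ^ j)⁻¹ * (θ ^ j * ‖g‖) := by
          gcongr; exact hpow j g
      _ = (θ / lam) ^ j * ‖g‖ := by rw [div_pow]; field_simp
      _ ≤ r ^ j * ‖g‖ := by gcongr; exact le_max_left _ _
  -- ### iterates: distance to `cφ`, size `U = 2‖b‖`
  have hxc : ∀ j, ‖(At ^ j) b - ⟪φ, b⟫ • φ‖ ≤ r ^ j * ‖b‖ := fun j => hpow' j b
  have hnb : ∀ j, ‖(At ^ j) b‖ ≤ 2 * ‖b‖ := fun j => norm_pow_apply_le_two_mul hφ hr0 hr1' hpow' j b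
  have hcU : |⟪φ, b⟫| ≤ 2 * ‖b‖ := by
    calc |⟪φ, b⟫| ≤ ‖φ‖ * ‖b‖ := abs_real_inner_le_norm _ _
      _ = ‖b‖ := by rw [hφ, one_mul]
      _ ≤ 2 * ‖b‖ := by linarith [norm_nonneg b]
  -- ### the partition function in normalised form
  have hZ : ∀ l k m', ⟪b, (A ^ (l + k + m')) b⟫ =
      lam ^ (l + k + m') * ⟪(At ^ l) b, (At ^ k) ((At ^ m') b)⟫ := by
    intro l k m'
    rw [hApow, real_inner_smul_right]
    congr 1
    rw [pow_add, pow_add, mul_apply_eq_comp, mul_apply_eq_comp, ← inner_pow_apply_comm hsym]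
  have hZlow : ∀ l k m', zs ≤ ⟪(At ^ l) b, (At ^ k) ((At ^ m') b)⟫ := by
    intro l k m'
    have h := hz (l + k + m')
    rw [hZ] at h
    exact le_of_mul_le_mul_left (by linarith [mul_comm zs (lam ^ (l + k + m'))]) (pow_pos hlam _)
  -- ### translation of `e2`, `e1`, `Cf` into normalised matrix elements
  have hE2 : ∀ l g m', e2 (l + g + 1 + m' + 1) l (l + g + 1) =
      ⟪(At ^ l) b, H₁ ((At ^ g) (H₁ ((At ^ m') b)))⟫ /
        (lam ^ 2 * ⟪(At ^ l) b, (At ^ (g + 2)) ((At ^ m') b)⟫) := by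
    intro l g m'
    have h1 : l + g + 1 - l - 1 = g := by omega
    have h2 : l + g + 1 + m' + 1 - 1 - (l + g + 1) = m' := by omega
    have hn : l + g + 1 + m' + 1 = l + (g + 2) + m' := by ring
    rw [he2 _ _ _ (by omega) (by omega), h1, h2, hn, hZ l (g + 2) m']
    simp only [hApow, map_smul, real_inner_smul_left, real_inner_smul_right]
    field_simp
    ring
  have hE1l : ∀ l g m', e1 (l + g + 1 + m' + 1) l =
      ⟪(At ^ l) b, H₁ ((At ^ (g + 1)) ((At ^ m') b))⟫ /
        (lam * ⟪(At ^ l) b, (At ^ (g + 2)) ((At ^ m') b)⟫) := by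
    intro l g m'
    have h1 : l + g + 1 + m' + 1 - 1 - l = (g + 1) + m' := by omega
    have hn : l + g + 1 + m' + 1 = l + (g + 2) + m' := by ring
    rw [he1 _ _ (by omega), h1, hn, hZ l (g + 2) m']
    simp only [hApow, map_smul, real_inner_smul_left, real_inner_smul_right]
    rw [pow_add At (g + 1) m', mul_apply_eq_comp]
    field_simp
    ring
  have hE1m : ∀ l g m', e1 (l + g + 1 + m' + 1) (l + g + 1) =
      ⟪(At ^ l) b, (At ^ (g + 1)) (H₁ ((At ^ m') b))⟫ /
        (lam * ⟪(At ^ l) b, (At ^ (g + 2)) ((At ^ m') b)⟫) := by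
    intro l g m'
    have h1 : l + g + 1 + m' + 1 - 1 - (l + g + 1) = m' := by omega
    have hn : l + g + 1 + m' + 1 = l + (g + 2) + m' := by ring
    rw [he1 _ _ (by omega), h1, hn, hZ l (g + 2) m']
    simp only [hApow, map_smul, real_inner_smul_left, real_inner_smul_right]
    have e : ⟪(At ^ (l + g + 1)) b, H₁ ((At ^ m') b)⟫ =
        ⟪(At ^ l) b, (At ^ (g + 1)) (H₁ ((At ^ m') b))⟫ := by
      rw [show l + g + 1 = (g + 1) + l by ring, pow_add, mul_apply_eq_comp, inner_pow_apply_comm hsym]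
    rw [e]
    field_simp
    ring
  have hE2d : ∀ l m', e2 (l + 1 + m') l l =
      ⟪(At ^ l) b, H₂ ((At ^ m') b)⟫ / (lam * ⟪(At ^ l) b, (At ^ 1) ((At ^ m') b)⟫) := by
    intro l m'
    have h1 : l + 1 + m' - 1 - l = m' := by omega
    rw [he2d _ _ (by omega), h1, hZ l 1 m']
    simp only [hApow, map_smul, real_inner_smul_left, real_inner_smul_right]
    field_simp
    ring
  have hE1d : ∀ l m', e1 (l + 1 + m') l =
      ⟪(At ^ l) b, H₁ ((At ^ m') b)⟫ / (lam * ⟪(At ^ l) b, (At ^ 1) ((At ^ m') b)⟫) := by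
    intro l m'
    have h1 : l + 1 + m' - 1 - l = m' := by omega
    rw [he1 _ _ (by omega), h1, hZ l 1 m']
    simp only [hApow, map_smul, real_inner_smul_left, real_inner_smul_right]
    field_simp
    ring
  have hCfoff : ∀ g, Cf (g + 1) = (⟪φ, H₁ ((At ^ g) (H₁ φ))⟫ - ⟪φ, H₁ φ⟫ ^ 2) / lam ^ 2 := by
    intro g
    rw [hCf (g + 1) (Nat.succ_pos g), Nat.add_sub_cancel, hApow, real_inner_smul_right,
      hH₁ φ ((At ^ g) (H₁ φ))]
    field_simp
    ring
  -- ### constants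
  set U : ℝ := 2 * ‖b‖ with hU
  have hbU : ∀ j, ‖(At ^ j) b‖ ≤ U := hnb
  set C₁a : ℝ := 12 * ‖H₁‖ ^ 2 * U ^ 4 / (lam ^ 2 * zs ^ 2) with hC₁a
  set C₁b : ℝ := ‖H₂‖ * U ^ 2 / zs / lam + (‖H₁‖ * U ^ 2 / zs) ^ 2 / lam ^ 2 with hC₁b
  set C₂a : ℝ := ((2 * ‖H₁‖ ^ 2 * U / zs + U ^ 2 * (2 * ‖H₁‖ ^ 2) * (2 * U) / zs ^ 2) +
      (2 * ‖H₁‖ * U / zs + U ^ 2 * (2 * ‖H₁‖) * (2 * U) / zs ^ 2) * (2 * ‖H₁‖ * U ^ 2 / zs) +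
      ‖H₁‖ * (2 * ‖H₁‖ * U / zs + U ^ 2 * (2 * ‖H₁‖) * (2 * U) / zs ^ 2)) / lam ^ 2 * ‖b‖
    with hC₂a
  set C₂b : ℝ := ((‖H₂‖ * U / zs + U ^ 2 * ‖H₂‖ * (2 * U) / zs ^ 2) / lam +
      (‖H₁‖ * U ^ 2 / zs + ‖H₁‖) * (‖H₁‖ * U / zs + U ^ 2 * ‖H₁‖ * (2 * U) / zs ^ 2) / lam ^ 2) *
      ‖b‖ with hC₂b
  set C₃ : ℝ := |⟪φ, H₂ φ⟫| / lam + ⟪φ, H₁ φ⟫ ^ 2 / lam ^ 2 + 2 * ‖H₁‖ ^ 2 / lam ^ 2 with hC₃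
  have hU0 : 0 ≤ U := by positivity
  have hC₁a0 : 0 ≤ C₁a := by positivity
  have hC₁b0 : 0 ≤ C₁b := by positivity
  have hC₂a0 : 0 ≤ C₂a := by positivity
  have hC₂b0 : 0 ≤ C₂b := by positivity
  -- ### the bounds for `l ≤ m`
  have key : ∀ n l m, l ≤ m → m < n →
      |e2 n l m - e1 n l * e1 n m| ≤ (C₁a + C₁b) * r ^ Nat.dist l m ∧
      |(e2 n l m - e1 n l * e1 n m) - Cf (Nat.dist l m)| ≤
        (C₂a + C₂b) * (r ^ l + r ^ (n - 1 - m)) := by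
    intro n l m hlm hmn
    rcases hlm.eq_or_lt with rfl | hlt
    · -- diagonal
      obtain ⟨m', rfl⟩ : ∃ m', n = l + 1 + m' := ⟨n - l - 1, by omega⟩
      have hd : Nat.dist l l = 0 := Nat.dist_self l
      have hm' : l + 1 + m' - 1 - l = m' := by omega
      rw [hd, pow_zero, mul_one, hm', hE2d, hE1d]
      refine ⟨?_, ?_⟩
      · calc _ ≤ C₁b := diag_decay (H := H₁) (H₂ := H₂) hlam hzs (hbU l) (hbU m') (hZlow l 1 m')
          _ ≤ C₁a + C₁b := le_add_of_nonneg_left hC₁a0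
      · rw [hCf0]
        calc _ ≤ ((‖H₂‖ * U / zs + U ^ 2 * ‖H₂‖ * (2 * U) / zs ^ 2) / lam +
              (‖H₁‖ * U ^ 2 / zs + ‖H₁‖) * (‖H₁‖ * U / zs + U ^ 2 * ‖H₁‖ * (2 * U) / zs ^ 2) /
                lam ^ 2) * (r ^ l * ‖b‖ + r ^ m' * ‖b‖) :=
              diag_limit (H := H₁) (H₂ := H₂) hφ hr0 hr1' hpow' hAtφ hlam hzs (hxc l) (hxc m')
                (hbU l) (hbU m') hcU hzc (hZlow l 1 m')
          _ = C₂b * (r ^ l + r ^ m') := by rw [hC₂b]; ring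
          _ ≤ (C₂a + C₂b) * (r ^ l + r ^ m') := by gcongr; exact le_add_of_nonneg_left hC₂a0
    · -- off-diagonal
      obtain ⟨g, rfl⟩ : ∃ g, m = l + g + 1 := ⟨m - l - 1, by omega⟩
      obtain ⟨m', rfl⟩ : ∃ m', n = l + g + 1 + m' + 1 := ⟨n - (l + g + 1) - 1, by omega⟩
      have hd : Nat.dist l (l + g + 1) = g + 1 := by
        rw [Nat.dist_eq_sub_of_le (by omega)]; omega
      have hm' : l + g + 1 + m' + 1 - 1 - (l + g + 1) = m' := by omega
      rw [hd, hm', hE2, hE1l, hE1m]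
      refine ⟨?_, ?_⟩
      · calc _ ≤ C₁a * r ^ (g + 1) :=
            offdiag_decay (H := H₁) hφ hr0 hr1' hrhalf hpow' hlam hzs (hbU l) (hbU m') g
              (hZlow l (g + 2) m')
          _ ≤ (C₁a + C₁b) * r ^ (g + 1) := by gcongr; exact le_add_of_nonneg_right hC₁b0
      · rw [hCfoff]
        calc _ ≤ ((2 * ‖H₁‖ ^ 2 * U / zs + U ^ 2 * (2 * ‖H₁‖ ^ 2) * (2 * U) / zs ^ 2) +
              (2 * ‖H₁‖ * U / zs + U ^ 2 * (2 * ‖H₁‖) * (2 * U) / zs ^ 2) *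
                (2 * ‖H₁‖ * U ^ 2 / zs) +
              ‖H₁‖ * (2 * ‖H₁‖ * U / zs + U ^ 2 * (2 * ‖H₁‖) * (2 * U) / zs ^ 2)) / lam ^ 2 *
              (r ^ l * ‖b‖ + r ^ m' * ‖b‖) :=
              offdiag_limit (H := H₁) hφ hr0 hr1' hpow' hAtφ hsym hlam hzs (hxc l) (hxc m') (hbU l)
                (hbU m') hcU hzc g (hZlow l (g + 2) m')
          _ = C₂a * (r ^ l + r ^ m') := by rw [hC₂a]; ring
          _ ≤ (C₂a + C₂b) * (r ^ l + r ^ m') := by gcongr; exact le_add_of_nonneg_right hC₂b0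
  -- ### conclusion (symmetry in `l, m`)
  refine ⟨C₁a + C₁b, C₂a + C₂b, C₃, r, hr0, hr1, ?_, ?_, ?_⟩
  · intro n l m hl hm
    rcases le_total l m with hlm | hml
    · exact (key n l m hlm hm).1
    · rw [he2s, mul_comm, Nat.dist_comm]
      exact (key n m l hml hl).1
  · intro n l m hl hm
    rcases le_total l m with hlm | hml
    · rw [min_eq_left hlm, max_eq_right hlm]
      exact (key n l m hlm hm).2
    · rw [he2s, mul_comm, Nat.dist_comm, min_eq_right hml, max_eq_left hml]
      exact (key n m l hml hl).2
  · intro d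
    have hc1 : 0 ≤ |⟪φ, H₂ φ⟫| / lam + ⟪φ, H₁ φ⟫ ^ 2 / lam ^ 2 := by positivity
    have hc2 : 0 ≤ 2 * ‖H₁‖ ^ 2 / lam ^ 2 := by positivity
    rcases Nat.eq_zero_or_pos d with rfl | hd
    · rw [hCf0, pow_zero, mul_one, hC₃]
      calc |⟪φ, H₂ φ⟫ / lam - (⟪φ, H₁ φ⟫ / lam) ^ 2| ≤ |⟪φ, H₂ φ⟫ / lam| + |(⟪φ, H₁ φ⟫ / lam) ^ 2| :=
            abs_sub _ _
        _ = |⟪φ, H₂ φ⟫| / lam + ⟪φ, H₁ φ⟫ ^ 2 / lam ^ 2 := by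
            rw [abs_div, abs_of_pos hlam, abs_pow, abs_div, abs_of_pos hlam, div_pow, sq_abs]
        _ ≤ _ := le_add_of_nonneg_right hc2
    · obtain ⟨g, rfl⟩ : ∃ g, d = g + 1 := ⟨d - 1, by omega⟩
      rw [hCfoff g, hC₃, add_mul]
      calc _ ≤ 2 * ‖H₁‖ ^ 2 / lam ^ 2 * r ^ (g + 1) :=
            abs_bulkCov_le (H := H₁) hφ hr0 hrhalf hpow' hH₁ hlam g
        _ ≤ _ := le_add_of_nonneg_left (mul_nonneg hc1 (pow_nonneg hr0 _))

end Packaging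

end Summit.AtomisticToContinuum.FouriersLaw.Theorems.SpecificHeatLimit

end
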